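import Summits.KontsevichZagierPeriods.KontsevichZagierPeriods.Theorems.MzvKernelInKZTwoPosetsDefs
import Summits.KontsevichZagierPeriods.KontsevichZagierPeriods.Theorems.FurushoPentagonHoffmanRelationInKZShuffleCells
import Summits.KontsevichZagierPeriods.KontsevichZagierPeriods.Theorems.FurushoPentagonHoffmanRelationInKZShuffleWords
import Literature.NumberTheory.Transcendental.KZProductIdeal

/-!
# `MzvKernelInKZ` (stmt-KontsevichZagierPeriods-3914), line two-posets-interior-landen: Hoffman's relation in depth one — the order polytope and its dissection

Support file for the stub `stub_hoffmanDepthOne` (`CubicalChart → InteriorLanden →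
HoffmanDepthOneInKZ`) of the crux `LinRedNormalForm.MzvKernelInKZ`.  Hoffman's relation in depth one
(Euler's depth-two sum formula, chain length `m + 1 = k`) is proved inside the Kontsevich–Zagier
calculus by a chain of moves starting from the ORDER POLYTOPE representation of the poset "a chain
of `m + 1` elements plus one extra element below its top":

`P_m = [{w ∈ ℝ^{m+2} | 1 > w₀ > ⋯ > w_m > 0, 0 < w_{m+1} < w₀}, ω₀(w₀)⋯ω₀(w_{m-1}) ω₁(w_m) ω₁(w_{m+1})]`.

This file supplies `P_m` together with its DISSECTION by the rank of the extra coordinate among the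
chain (rule 1a, `m + 1` linear extensions; the walls `{w_{m+1} = w_i}` are null):
`[P_m] ≡ Σ_{j<m} [ζ(m+1-j, j+1)] + [ζ(m+1, 1)]` modulo `KZ.relations` (`stub_hoffmanDepthOnePolytope`,
registered sub-goal).  Both the existence of the representation and the dissection are the tree's
shuffle-cell theorem `FurushoPentagon.HoffmanRelationInKZ.stub_shuffleCells` (there the extra
coordinate is the FIRST one; one coordinate rotation `KZ.IntegralRep.reindex (finRotate _).symm`, a
change-of-variables move, puts it last), with the inserted words identified by `stub_shuffleWords`;
the brackets `zIdx` of this line are pinned to the tree's simplex classes `KZ.mzvRep`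
(`zIdx_one_eq_of_mzvRep`, an equality of representations).  Also here: admissibility of the word of
an admissible index (`adm_bword`) and the unfolding of `zIdx` at a prescribed weight (`zIdx_eq`).

References: M. Kontsevich, D. Zagier, *Periods* (2001), §1.2; M. E. Hoffman, *Multiple harmonic
series*, Pacific J. Math. 152 (1992), Thm 5.1; M. Kaneko, S. Yamamoto, Selecta Math. 24 (2018)
(integrals attached to 2-posets).
-/

noncomputable section

namespace Summit.KontsevichZagierPeriods.MzvKernelInKZ.TwoPosets

open Set MeasureTheory
open Literature.NumberTheory.Transcendental
open Summit.KontsevichZagierPeriods.MzvKernelInKZ.Negative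

namespace HoffmanDepthOne

open Summit.KontsevichZagierPeriods.FurushoPentagon.HoffmanRelationInKZ
  (stub_shuffleCells stub_shuffleWords)
open Summit.KontsevichZagierPeriods.HoffmanRelationInKZ.Negative (list_sum_range_map_finset)

/-! ## Words of admissible indices; the bracket `zIdx` unfolded -/

/-- The word of an admissible index of weight `N` is admissible in the sense of `Negative.Adm`
(first letter `0` since `s₁ ≥ 2`, last letter `1`). [cite: Zagier1994, §9] -/
theorem adm_bword {s : List ℕ} {N : ℕ} (hs : MZV.IsAdmissible s) (hw : MZV.weight s = N) :
    Adm (bword N s) := by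
  subst hw
  intro hpos
  have hne : s ≠ [] := by
    rintro rfl
    simp [MZV.weight] at hpos
  obtain ⟨a, s', rfl⟩ := List.exists_cons_of_ne_nil hne
  have ha : 2 ≤ a := hs.2 (List.cons_ne_nil a s')
  have hlen : (MZV.binaryWord (a :: s')).length = MZV.weight (a :: s') := hs.length_binaryWord
  refine ⟨?_, ?_⟩
  · show (MZV.binaryWord (a :: s')).getD 0 false = false
    have h := MZV.head?_binaryWord (s := s') ha
    rw [List.head?_eq_getElem?] at h
    rw [List.getD_eq_getElem?_getD, h]
    rfl
  · show (MZV.binaryWord (a :: s')).getD (MZV.weight (a :: s') - 1) false = true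
    have h := MZV.getLast?_binaryWord (List.cons_ne_nil a s')
    rw [List.getLast?_eq_getElem?, hlen] at h
    rw [List.getD_eq_getElem?_getD, h]
    rfl

/-- The bracket of an index at a prescribed weight: for `MZV.weight s = N` and admissible letters,
`zIdx s q = [Δ_N, q · ω_s]`. [cite: KontsevichZagier2001, §1.1] -/
theorem zIdx_eq {s : List ℕ} {N : ℕ} (hw : MZV.weight s = N) (h : Adm (bword N s)) (q : ℚ) :
    zIdx s q = KZ.of (wordRep (bword N s) q h) := by
  subst hw
  simp only [zIdx, zWord, dif_pos h]

/-- The tree's iterated-integral integrand `KZ.mzvIntegrand s` is the word integrand of the word of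
`s` with coefficient `1`. [cite: KontsevichZagier2001, §1.1] -/
theorem mzvIntegrand_eq_wordFun (s : List ℕ) (t : Fin (MZV.weight s) → ℝ) :
    KZ.mzvIntegrand s t = wordFun (bword (MZV.weight s) s) 1 t := by
  rw [wordFun_one_eq_prod_mzvForm]
  rfl

/-- **Pinning.** On admissible indices the bracket `zIdx u 1` IS the class of the tree's simplex
representation `KZ.mzvRep u` (same domain, same integrand function: equal representations).
[cite: KontsevichZagier2001, §1.1] -/
theorem zIdx_one_eq_of_mzvRep {u : List ℕ} (hu : MZV.IsAdmissible u) :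
    zIdx u 1 = KZ.of (KZ.mzvRep u hu (KZ.mzvIntegrand_isSemialgebraicFunOn_holds u)
      (KZ.mzvIntegrand_integrableOn_holds u hu)) := by
  rw [zIdx_eq rfl (adm_bword hu rfl) 1]
  congr 1
  exact KZ.IntegralRep.ext' rfl (funext fun t => (mzvIntegrand_eq_wordFun u t).symm)

/-! ## The order polytope of the chain-plus-one poset and its dissection -/

/-- The chain `[m+1]` is an admissible index for `m ≥ 1`. [cite: Zagier1994, §1] -/
theorem isAdmissible_chain {m : ℕ} (hm : 1 ≤ m) : MZV.IsAdmissible [m + 1] :=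
  ⟨fun i hi => by simp at hi; omega, fun _ => by show 2 ≤ m + 1; omega⟩

/-- The inserted words of the chain, summed: the `m + 1` words obtained from `0^m 1` by inserting
one letter `1` read back as indices give `Σ_{j<m} [ζ(m+1-j, j+1)] + [ζ(m+1, 1)]`
(`stub_shuffleWords` at `s = (m+1)`). [cite: Hoffman1992, Thm 5.1] -/
theorem sum_insertedWords_chain {m : ℕ} (hm : 1 ≤ m) :
    ((List.range (m + 1)).map fun g =>
        zIdx (MZV.ofBinaryWord ((MZV.binaryWord [m + 1]).insertIdx (g + 1) true)) 1).sum =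
      ∑ j ∈ Finset.range m, zIdx [m + 1 - j, j + 1] 1 + zIdx [m + 1, 1] 1 := by
  calc ((List.range (m + 1)).map fun g =>
        zIdx (MZV.ofBinaryWord ((MZV.binaryWord [m + 1]).insertIdx (g + 1) true)) 1).sum
      = _ := stub_shuffleWords [m + 1] (isAdmissible_chain hm) (fun u => zIdx u 1)
    _ = ∑ j ∈ Finset.range m, zIdx [m + 1 - j, j + 1] 1 + zIdx [m + 1, 1] 1 := by
        simp [list_sum_range_map_finset]

/-- **The shuffle cells of the chain** (tree theorem `stub_shuffleCells` at `s = (m+1)`, pinned to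
`zIdx`): the representation `[{t ∈ Δ^{m+1}, 0 < u < t₀}, ω_{0^m1}(t)/(1-u)]` exists, and each such
representation is `≡ Σ_{j<m} [ζ(m+1-j, j+1)] + [ζ(m+1,1)]` modulo `KZ.relations`.
[cite: KontsevichZagier2001, §1.2 rule (1)] -/
theorem shuffleCells_chain {m : ℕ} (hm : 1 ≤ m) :
    (∃ r : KZ.IntegralRep (m + 2),
      r.domain = {y : Fin (m + 2) → ℝ | Fin.tail y ∈ simplex (m + 1) ∧ 0 < y 0 ∧ y 0 < y 1} ∧
      EqOn r.integrand (fun y => wordFun (bword (m + 1) [m + 1]) 1 (Fin.tail y) / (1 - y 0))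
        r.domain) ∧
    ∀ r : KZ.IntegralRep (m + 2),
      r.domain = {y : Fin (m + 2) → ℝ | Fin.tail y ∈ simplex (m + 1) ∧ 0 < y 0 ∧ y 0 < y 1} →
      EqOn r.integrand (fun y => wordFun (bword (m + 1) [m + 1]) 1 (Fin.tail y) / (1 - y 0))
        r.domain →
      KZ.of r - (∑ j ∈ Finset.range m, zIdx [m + 1 - j, j + 1] 1 + zIdx [m + 1, 1] 1) ∈
        KZ.relations := by
  obtain ⟨⟨r, hrd, hri⟩, hdis⟩ :
      (∃ r' : KZ.IntegralRep (m + 2),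
        r'.domain = {y : Fin (m + 2) → ℝ | Fin.tail y ∈ simplex (m + 1) ∧ 0 < y 0 ∧ y 0 < y 1} ∧
        EqOn r'.integrand (fun y => KZ.mzvIntegrand [m + 1] (Fin.tail y) / (1 - y 0)) r'.domain) ∧
      ∀ r' : KZ.IntegralRep (m + 2),
        (r'.domain = {y : Fin (m + 2) → ℝ | Fin.tail y ∈ simplex (m + 1) ∧ 0 < y 0 ∧ y 0 < y 1} ∧
        EqOn r'.integrand (fun y => KZ.mzvIntegrand [m + 1] (Fin.tail y) / (1 - y 0)) r'.domain) →
        KZ.of r' - ((List.range (m + 1)).map fun g =>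
          zIdx (MZV.ofBinaryWord ((MZV.binaryWord [m + 1]).insertIdx (g + 1) true)) 1).sum ∈
          KZ.relations :=
    stub_shuffleCells [m + 1] (isAdmissible_chain hm) (List.cons_ne_nil _ _) (fun u => zIdx u 1)
      fun u hu => zIdx_one_eq_of_mzvRep hu
  have key : ∀ t : Fin (m + 1) → ℝ,
      KZ.mzvIntegrand [m + 1] t = wordFun (bword (m + 1) [m + 1]) 1 t :=
    fun t => mzvIntegrand_eq_wordFun [m + 1] t
  refine ⟨⟨r, hrd, fun y hy => ?_⟩, fun r' hr'd hr'i => ?_⟩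
  · rw [hri hy]
    exact congrArg (fun a => a / (1 - y 0)) (key (Fin.tail y))
  · rw [← sum_insertedWords_chain hm]
    refine hdis r' ⟨hr'd, fun y hy => ?_⟩
    rw [hr'i hy]
    exact congrArg (fun a => a / (1 - y 0)) (key (Fin.tail y)).symm

/-- The rotation `(finRotate (m+2))⁻¹` sends `0` to the last coordinate. [folklore] -/
theorem finRotate_symm_zero (m : ℕ) : (finRotate (m + 2)).symm 0 = Fin.last (m + 1) := by
  rw [Equiv.symm_apply_eq]
  exact finRotate_last.symm

/-- The rotation `(finRotate (m+2))⁻¹` sends `j + 1` to `j`. [folklore] -/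
theorem finRotate_symm_succ (m : ℕ) (j : Fin (m + 1)) :
    (finRotate (m + 2)).symm j.succ = j.castSucc := by
  rw [Equiv.symm_apply_eq, finRotate_apply, Fin.coeSucc_eq_succ]

/-- Reading a tuple along `(finRotate (m+2))⁻¹` and dropping the head gives its initial segment.
[folklore] -/
theorem tail_comp_finRotate_symm (m : ℕ) (w : Fin (m + 2) → ℝ) :
    Fin.tail (fun i => w ((finRotate (m + 2)).symm i)) = Fin.init w := by
  funext j
  simp only [Fin.tail, finRotate_symm_succ]
  rfl

/-- **The order polytope and its dissection.** For `m ≥ 1` there is a representation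
`P = [{1 > w₀ > ⋯ > w_m > 0, 0 < w_{m+1} < w₀}, ω_{0^m1}(w₀,…,w_m)/(1 - w_{m+1})]` (the order polytope of
the chain of length `m + 1` with one extra element below its top), and
`[P] − (Σ_{j<m} [ζ(m+1-j, j+1)] + [ζ(m+1, 1)]) ∈ KZ.relations`: one coordinate rotation (rule 2,
`KZ.of_sub_of_reindex_mem_relations`) of the shuffle-cell representation, then the dissection by the
rank of `w_{m+1}` in the chain (rule 1a, `shuffleCells_chain`).  Registered sub-goal of
`stub_hoffmanDepthOne`. [cite: KontsevichZagier2001, §1.2] -/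
theorem _root_.Summit.KontsevichZagierPeriods.MzvKernelInKZ.TwoPosets.stub_hoffmanDepthOnePolytope : ∀ m : ℕ, 1 ≤ m → ∃ P : KZ.IntegralRep (m + 2), P.domain = {w : Fin (m + 2) → ℝ | Fin.init w ∈ simplex (m + 1) ∧ 0 < w (Fin.last (m + 1)) ∧ w (Fin.last (m + 1)) < w 0} ∧ EqOn P.integrand (fun w => wordFun (bword (m + 1) [m + 1]) 1 (Fin.init w) / (1 - w (Fin.last (m + 1)))) P.domain ∧ KZ.of P - (∑ j ∈ Finset.range m, zIdx [m + 1 - j, j + 1] 1 + zIdx [m + 1, 1] 1) ∈ KZ.relations := by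
  intro m hm
  obtain ⟨⟨r, hrd, hri⟩, hdis⟩ := shuffleCells_chain hm
  set e : Fin (m + 2) ≃ Fin (m + 2) := (finRotate (m + 2)).symm with he
  have he0 : e 0 = Fin.last (m + 1) := finRotate_symm_zero m
  have he1 : e 1 = 0 := by
    rw [← Fin.succ_zero_eq_one]; exact finRotate_symm_succ m 0
  have htail : ∀ w : Fin (m + 2) → ℝ, Fin.tail (fun i => w (e i)) = Fin.init w :=
    tail_comp_finRotate_symm m
  have hdom : (r.reindex e).domain = {w : Fin (m + 2) → ℝ | Fin.init w ∈ simplex (m + 1) ∧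
      0 < w (Fin.last (m + 1)) ∧ w (Fin.last (m + 1)) < w 0} := by
    ext w
    simp only [KZ.IntegralRep.reindex_domain, hrd, mem_setOf_eq, htail, he0, he1]
  refine ⟨r.reindex e, hdom, fun w hw => ?_, ?_⟩
  · have hw' : (fun i => w (e i)) ∈ r.domain := by
      rw [hdom] at hw
      rw [hrd]
      simpa only [mem_setOf_eq, htail, he0, he1] using hw
    simp only [KZ.IntegralRep.reindex_integrand]
    rw [hri hw']
    simp only [htail, he0]
  · have h1 := hdis r hrd hri
    have h2 := KZ.of_sub_of_reindex_mem_relations r e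
    convert KZ.relations.sub_mem h1 h2 using 1
    abel

end HoffmanDepthOne

end Summit.KontsevichZagierPeriods.MzvKernelInKZ.TwoPosets
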